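import Summits.QuantumFields.YangMills.Theses.DirichletWindow

/-!
# Birth skeleton (BC3) for crux `BoxLaplace` (stmt-QuantumFields-12316) — `Lines/birth.lean`

Registrar: `planner-skel-stmt-QuantumFields-12316-0` (skeleton-register one-shot; route
`route-QuantumFields-DirichletWindow`, re-audit bin REPAIRABLE), 2026-08-17.

Crux (route file `Theses/DirichletWindow.lean`, decl
`Summit.QuantumFields.YangMills.Theses.DirichletWindow.BoxLaplace`, rank 3, XL): the mesoscopic
background-field Laplace lemma with Dirichlet data — in the box `Λ` of side `2⌈β^θ⌉+1`, for EVERY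
exterior datum `ω` whose Wilson kernel gives the small-field event `good` probability `≥ 1/2`,
the conditioned kernel `ν ω` has (i) the two-point lower bound
`Cov(P₀,P_x) ≥ 2A/(β²n⁸) − C(D₀⁺+D_x⁺)/(βn⁴) − C(D₀⁺+D_x⁺)² − C/β^(2+δ')`, (ii) the one-point bound
`Var(P₀) ≤ B/β² + C D₀⁺/β + C (D₀⁺)²`, (iii) the excess-action floor `D₀, D_x ≥ −C/β^(1+δ')`,
where `D_y(ω) = E_{ν ω}[N − Re tr U_y] − E_{ν 1}[N − Re tr U_y]` is the conditional excess action
relative to FLAT Dirichlet data `ω = 1`.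

## The cut: flat box / background at second order / near-minimality of flat data

The route's own two-layer plan (route header, TWO-LAYER PLAN: `BoxLaplace ⇐ FlatBoxGaussianity →
MinimiserCentresMean → BackgroundSecondOrder`) is typed here WITHOUT positing the constrained
minimiser as an object (it lives inside proofs): every quantity below is already in the crux.

* `stub_flatBoxGaussianity` — **the flat Dirichlet box alone** (`ω = 1`, no exterior datum): the
  one-scale Laplace asymptotics of Wilson's kernel conditioned on `good`, in complete axial gauge
  around the trivial minimiser: `Cov_{ν 1}(P₀,P_{ne₀}) ≥ 2A/(β²n⁸) − C/β^(2+δ')` (lead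
  `c_r·D·G_M(ne₀)²/β²`, `G_M` the lattice-Maxwell curvature propagator of the Dirichlet box,
  `→ −1/(π²n⁴)` as `L → ∞`) and `Var_{ν 1}(P₀) ≤ B/β²`.  It OWNS `θ` (`∃ θ ∈ (0, 1/16]`).
  Why it might fail: crude one-scale anharmonic remainders `~L⁶β^(−13/32)` close only for
  `θ < 13/192`; `G_M(ne₀) ≠ 0` for large `n` and the Dirichlet finite-size correction are owed on
  the lattice (Lawler–Limic §4.3-type fourth-difference asymptotics).  Size L.
* `stub_backgroundSecondOrder` — **the exterior datum enters only at second order**, for EVERY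
  `θ ∈ (0, 1/16]`: comparison of the `ω`-kernel with the flat kernel at the centre,
  `Cov_{ν ω}(P₀,P_x) ≥ Cov_{ν 1}(P₀,P_x) − C(D₀⁺+D_x⁺)/(βn⁴) − C(D₀⁺+D_x⁺)² − C/β^(2+δ')` and
  `Var_{ν ω}(P₀) ≤ Var_{ν 1}(P₀) + C D₀⁺/β + C (D₀⁺)² + C/β^(2+δ')` (cross term `c'h₀h_xG_M/β`
  with `h_y²/2 ≲ D_y⁺ + O(β^(−1−δ'))`, mixture over near-degenerate constrained minimisers
  `≤ C(D₀+D_x)²`, `O(h)` shift of the fluctuation spectrum inside `C/β^(2+δ')`).  Stated for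
  `n ≥ 1` (at `n = 0` Lean's `x/0 = 0` would silently drop the `1/(βn⁴)` term).
  Why it might fail: the `O(h)` fluctuation-spectrum shift and the minimiser mixture must really
  be second order in `h` UNIFORMLY in `ω` (kit j003055: two minima at `L = 10`).  Size XL — the
  load-bearing stub.
* `stub_excessFloor` — **flat data nearly minimise the conditional mean action at the centre**,
  for EVERY `θ ∈ (0, 1/16]`: `D₀(ω), D_x(ω) ≥ −C/β^(1+δ')` for every admissible `ω` (Gaussian
  equipartition makes the local fluctuation energy background-independent at first order; the
  colour trace kills the linear spin term).  Why it might fail: consistent only for `δ' ≲ 4θ`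
  (Dirichlet finite-size correction `~1/(βL⁴)` of the flat fluctuation energy; refuter crux-attack
  2026-08-15), so `δ'` must be chosen with `θ`.  Size M–L.
* `glue : Glue` — the composition with the three stub STATEMENTS as explicit hypotheses
  (`Glue := <sig₁> → <sig₂> → <sig₃> → BoxLaplace`), a real `sorry`-free proof: instantiate the
  two `∀ θ` stubs at the flat stub's `θ`, merge constants (`C := |C₁|+|C₂|+|C₃|`,
  `δ' := min δ₁ (min δ₂ δ₃)`, `B := B₁+|C₂|`, `n₀ := max n₀ 1`, `β₁ := max of the three and 1`)
  and chain the inequalities (pure real arithmetic, lemmas `glue_cov`, `glue_var`, `glue_floor`).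
* `BoxLaplace_of : BoxLaplace` — the registered form: `glue` applied to the three stubs BY NAME
  (what `ledger skeleton check` audits: concludes the crux by name, sorries only in `stub_*`).

BC3 probes (registrar folder `bc/probe_*.lean`): for each stub, `stub → BoxLaplace` and
`stub → YangMills` by `first | exact? | simpa | aesop` FAIL (no stub is cheaply the crux or the
summit).  Disproof used: none exists for this crux (`ledger crux ls`: no workfiles, 2026-08-17).

`lean check`: rc 0; sorries = 3 = stubs (`stub_flatBoxGaussianity`, `stub_backgroundSecondOrder`,
`stub_excessFloor`), zero elsewhere.  Namespace `Summit.QuantumFields.YangMills.Cruxes.BoxLaplace.Birth`.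
-/

noncomputable section

namespace Summit.QuantumFields.YangMills.Cruxes.BoxLaplace.Birth

open Summit.QuantumFields.YangMills.Theses.DirichletWindow

/-! ## The three stubs (signatures fully qualified, self-contained like the crux) -/

/-- **Stub 1 — flat-box Gaussianity (OPEN).**  Wilson's Dirichlet kernel with FLAT exterior data
`ω = 1` on the box of side `2⌈β^θ⌉+1`, conditioned on the small-field event, is Gaussian at the
centre to leading order: two-point lower bound `2A/(β²n⁸) − C/β^(2+δ')` at separation `n e₀` and
one-point bound `Var(P₀) ≤ B/β²`, for some `θ ∈ (0, 1/16]` (this stub owns `θ`). -/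
theorem stub_flatBoxGaussianity :
    ∀ (G : Type) [Group G] [TopologicalSpace G] [IsTopologicalGroup G] [CompactSpace G]
      [MeasurableSpace G] [BorelSpace G],
      Literature.MathematicalPhysics.QuantumFieldTheory.IsCompactSimpleLieGroup G →
      ∀ r : Literature.MathematicalPhysics.QuantumFieldTheory.LatticeRep G,
      ∃ θ A B C δ' : ℝ, ∃ n₀ : ℕ, 0 < θ ∧ θ ≤ 1 / 16 ∧ 0 < A ∧ 0 < δ' ∧
        ∀ n : ℕ, n₀ ≤ n → ∃ β₁ : ℝ, ∀ β : ℝ, β₁ ≤ β →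
          let Λ : Finset (Literature.MathematicalPhysics.QuantumLattice.ZdEdge 4) :=
            Literature.Probability.LatticeModels.box 4 ⌈β ^ θ⌉₊ ×ˢ (Finset.univ : Finset (Fin 4))
          let good : Set (Literature.MathematicalPhysics.QuantumLattice.LGConfig 4 G) :=
            {U | ∀ p ∈ Literature.MathematicalPhysics.QuantumLattice.plaquettesTouching Λ,
              (r.N : ℝ) - Literature.MathematicalPhysics.QuantumLattice.plaquetteObs r.ρ p.1
                p.2.1.1 p.2.1.2 U ≤ β ^ (-(15 : ℝ) / 16)}
          let ν : Literature.MathematicalPhysics.QuantumLattice.LGConfig 4 G →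
              MeasureTheory.Measure (Literature.MathematicalPhysics.QuantumLattice.LGConfig 4 G) :=
            fun η => ProbabilityTheory.cond
              (Literature.MathematicalPhysics.QuantumLattice.ymSpecification r.ρ β Λ η) good
          let x : Literature.Probability.LatticeModels.Site 4 := (n : ℤ) • Pi.single (0 : Fin 4) (1 : ℤ)
          2 * A / (β ^ 2 * (n : ℝ) ^ 8) - C / β ^ (2 + δ') ≤
              Literature.MathematicalPhysics.QuantumLattice.plaquetteCorrFn r.ρ (ν 1) x ∧
            Literature.MathematicalPhysics.QuantumLattice.plaquetteCorrFn r.ρ (ν 1) 0 ≤ B / β ^ 2 := by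
  sorry

/-- **Stub 2 — the exterior datum enters only at second order (OPEN; load-bearing).**  For every
`θ ∈ (0, 1/16]` and every separation `n ≥ 1`, at all large `β`: for EVERY exterior datum `ω`
whose kernel gives the small-field event probability `≥ 1/2`, the centre covariance and variance
of the conditioned `ω`-kernel differ from those of the FLAT kernel only through the conditional
excess actions `D₀⁺, D_x⁺`, at second order:
`Cov_ω ≥ Cov_1 − C(D₀⁺+D_x⁺)/(βn⁴) − C(D₀⁺+D_x⁺)² − C/β^(2+δ')`,
`Var_ω ≤ Var_1 + C D₀⁺/β + C (D₀⁺)² + C/β^(2+δ')`. -/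
theorem stub_backgroundSecondOrder :
    ∀ (G : Type) [Group G] [TopologicalSpace G] [IsTopologicalGroup G] [CompactSpace G]
      [MeasurableSpace G] [BorelSpace G],
      Literature.MathematicalPhysics.QuantumFieldTheory.IsCompactSimpleLieGroup G →
      ∀ r : Literature.MathematicalPhysics.QuantumFieldTheory.LatticeRep G,
      ∀ θ : ℝ, 0 < θ → θ ≤ 1 / 16 → ∃ C δ' : ℝ, 0 < δ' ∧
        ∀ n : ℕ, 1 ≤ n → ∃ β₁ : ℝ, ∀ β : ℝ, β₁ ≤ β →
          let Λ : Finset (Literature.MathematicalPhysics.QuantumLattice.ZdEdge 4) :=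
            Literature.Probability.LatticeModels.box 4 ⌈β ^ θ⌉₊ ×ˢ (Finset.univ : Finset (Fin 4))
          let good : Set (Literature.MathematicalPhysics.QuantumLattice.LGConfig 4 G) :=
            {U | ∀ p ∈ Literature.MathematicalPhysics.QuantumLattice.plaquettesTouching Λ,
              (r.N : ℝ) - Literature.MathematicalPhysics.QuantumLattice.plaquetteObs r.ρ p.1
                p.2.1.1 p.2.1.2 U ≤ β ^ (-(15 : ℝ) / 16)}
          let ν : Literature.MathematicalPhysics.QuantumLattice.LGConfig 4 G →
              MeasureTheory.Measure (Literature.MathematicalPhysics.QuantumLattice.LGConfig 4 G) :=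
            fun η => ProbabilityTheory.cond
              (Literature.MathematicalPhysics.QuantumLattice.ymSpecification r.ρ β Λ η) good
          let D : Literature.Probability.LatticeModels.Site 4 →
              Literature.MathematicalPhysics.QuantumLattice.LGConfig 4 G → ℝ := fun y η =>
            (∫ U, ((r.N : ℝ) - Literature.MathematicalPhysics.QuantumLattice.plaquetteObs r.ρ y 0 1 U)
                ∂(ν η)) -
              ∫ U, ((r.N : ℝ) - Literature.MathematicalPhysics.QuantumLattice.plaquetteObs r.ρ y 0 1 U)
                ∂(ν 1)
          let x : Literature.Probability.LatticeModels.Site 4 := (n : ℤ) • Pi.single (0 : Fin 4) (1 : ℤ)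
          ∀ ω : Literature.MathematicalPhysics.QuantumLattice.LGConfig 4 G,
            (2⁻¹ : ENNReal) ≤
                Literature.MathematicalPhysics.QuantumLattice.ymSpecification r.ρ β Λ ω good →
              Literature.MathematicalPhysics.QuantumLattice.plaquetteCorrFn r.ρ (ν 1) x -
                    C * (max (D 0 ω) 0 + max (D x ω) 0) / (β * (n : ℝ) ^ 4) -
                    C * (max (D 0 ω) 0 + max (D x ω) 0) ^ 2 - C / β ^ (2 + δ') ≤
                  Literature.MathematicalPhysics.QuantumLattice.plaquetteCorrFn r.ρ (ν ω) x ∧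
                Literature.MathematicalPhysics.QuantumLattice.plaquetteCorrFn r.ρ (ν ω) 0 ≤
                  Literature.MathematicalPhysics.QuantumLattice.plaquetteCorrFn r.ρ (ν 1) 0 +
                    C * max (D 0 ω) 0 / β + C * max (D 0 ω) 0 ^ 2 + C / β ^ (2 + δ') := by
  sorry

/-- **Stub 3 — flat data nearly minimise the conditional mean action (OPEN).**  For every
`θ ∈ (0, 1/16]` there are `C` and `δ' > 0` (necessarily `δ' ≲ 4θ`) such that for every separation
`n`, at all large `β`, for EVERY admissible exterior datum `ω`: the conditional excess actions at
the two observed plaquettes satisfy `D₀(ω) ≥ −C/β^(1+δ')` and `D_x(ω) ≥ −C/β^(1+δ')`. -/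
theorem stub_excessFloor :
    ∀ (G : Type) [Group G] [TopologicalSpace G] [IsTopologicalGroup G] [CompactSpace G]
      [MeasurableSpace G] [BorelSpace G],
      Literature.MathematicalPhysics.QuantumFieldTheory.IsCompactSimpleLieGroup G →
      ∀ r : Literature.MathematicalPhysics.QuantumFieldTheory.LatticeRep G,
      ∀ θ : ℝ, 0 < θ → θ ≤ 1 / 16 → ∃ C δ' : ℝ, 0 < δ' ∧
        ∀ n : ℕ, ∃ β₁ : ℝ, ∀ β : ℝ, β₁ ≤ β →
          let Λ : Finset (Literature.MathematicalPhysics.QuantumLattice.ZdEdge 4) :=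
            Literature.Probability.LatticeModels.box 4 ⌈β ^ θ⌉₊ ×ˢ (Finset.univ : Finset (Fin 4))
          let good : Set (Literature.MathematicalPhysics.QuantumLattice.LGConfig 4 G) :=
            {U | ∀ p ∈ Literature.MathematicalPhysics.QuantumLattice.plaquettesTouching Λ,
              (r.N : ℝ) - Literature.MathematicalPhysics.QuantumLattice.plaquetteObs r.ρ p.1
                p.2.1.1 p.2.1.2 U ≤ β ^ (-(15 : ℝ) / 16)}
          let ν : Literature.MathematicalPhysics.QuantumLattice.LGConfig 4 G →
              MeasureTheory.Measure (Literature.MathematicalPhysics.QuantumLattice.LGConfig 4 G) :=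
            fun η => ProbabilityTheory.cond
              (Literature.MathematicalPhysics.QuantumLattice.ymSpecification r.ρ β Λ η) good
          let D : Literature.Probability.LatticeModels.Site 4 →
              Literature.MathematicalPhysics.QuantumLattice.LGConfig 4 G → ℝ := fun y η =>
            (∫ U, ((r.N : ℝ) - Literature.MathematicalPhysics.QuantumLattice.plaquetteObs r.ρ y 0 1 U)
                ∂(ν η)) -
              ∫ U, ((r.N : ℝ) - Literature.MathematicalPhysics.QuantumLattice.plaquetteObs r.ρ y 0 1 U)
                ∂(ν 1)
          let x : Literature.Probability.LatticeModels.Site 4 := (n : ℤ) • Pi.single (0 : Fin 4) (1 : ℤ)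
          ∀ ω : Literature.MathematicalPhysics.QuantumLattice.LGConfig 4 G,
            (2⁻¹ : ENNReal) ≤
                Literature.MathematicalPhysics.QuantumLattice.ymSpecification r.ρ β Λ ω good →
              -(C / β ^ (1 + δ')) ≤ D 0 ω ∧ -(C / β ^ (1 + δ')) ≤ D x ω := by
  sorry

/-! ## Pure real arithmetic of the constant merge (sorry-free) -/

/-- Conjunct (i): flat lower bound + second-order comparison, constants absorbed into
`C ≥ |C₁| + |C₂|`, `δ ≤ min δ₁ δ₂`, for `β ≥ 1`. -/
theorem glue_cov {A C₁ C₂ C δ₁ δ₂ δ β n S P₁ P : ℝ}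
    (hC₂ : |C₂| ≤ C) (hC₁₂ : |C₁| + |C₂| ≤ C) (hδ₁ : δ ≤ δ₁) (hδ₂ : δ ≤ δ₂)
    (hβ : 1 ≤ β) (hn : 0 ≤ n) (hS : 0 ≤ S)
    (h₁ : 2 * A / (β ^ 2 * n ^ 8) - C₁ / β ^ (2 + δ₁) ≤ P₁)
    (h₂ : P₁ - C₂ * S / (β * n ^ 4) - C₂ * S ^ 2 - C₂ / β ^ (2 + δ₂) ≤ P) :
    2 * A / (β ^ 2 * n ^ 8) - C * S / (β * n ^ 4) - C * S ^ 2 - C / β ^ (2 + δ) ≤ P := by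
  have hβ0 : 0 < β := lt_of_lt_of_le one_pos hβ
  have e1 : C₁ / β ^ (2 + δ₁) ≤ |C₁| / β ^ (2 + δ) :=
    calc C₁ / β ^ (2 + δ₁) ≤ |C₁| / β ^ (2 + δ₁) :=
          div_le_div_of_nonneg_right (le_abs_self _) (Real.rpow_nonneg hβ0.le _)
      _ ≤ |C₁| / β ^ (2 + δ) :=
          div_le_div_of_nonneg_left (abs_nonneg _) (Real.rpow_pos_of_pos hβ0 _)
            (Real.rpow_le_rpow_of_exponent_le hβ (by linarith))
  have e2 : C₂ / β ^ (2 + δ₂) ≤ |C₂| / β ^ (2 + δ) :=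
    calc C₂ / β ^ (2 + δ₂) ≤ |C₂| / β ^ (2 + δ₂) :=
          div_le_div_of_nonneg_right (le_abs_self _) (Real.rpow_nonneg hβ0.le _)
      _ ≤ |C₂| / β ^ (2 + δ) :=
          div_le_div_of_nonneg_left (abs_nonneg _) (Real.rpow_pos_of_pos hβ0 _)
            (Real.rpow_le_rpow_of_exponent_le hβ (by linarith))
  have e3 : (|C₁| + |C₂|) / β ^ (2 + δ) ≤ C / β ^ (2 + δ) :=
    div_le_div_of_nonneg_right hC₁₂ (Real.rpow_nonneg hβ0.le _)
  have e4 : C₂ * S / (β * n ^ 4) ≤ C * S / (β * n ^ 4) :=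
    div_le_div_of_nonneg_right (mul_le_mul_of_nonneg_right ((le_abs_self _).trans hC₂) hS)
      (mul_nonneg hβ0.le (pow_nonneg hn 4))
  have e5 : C₂ * S ^ 2 ≤ C * S ^ 2 :=
    mul_le_mul_of_nonneg_right ((le_abs_self _).trans hC₂) (sq_nonneg _)
  rw [add_div] at e3
  linarith

/-- Conjunct (ii): flat variance bound + second-order comparison, `B := B₁ + |C₂|`, `C ≥ |C₂|`,
for `β ≥ 1`. -/
theorem glue_var {B₁ C₂ C δ₂ β T P₁ P : ℝ} (hC₂ : |C₂| ≤ C) (hδ₂ : 0 ≤ δ₂) (hβ : 1 ≤ β)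
    (hT : 0 ≤ T) (h₁ : P₁ ≤ B₁ / β ^ 2)
    (h₂ : P ≤ P₁ + C₂ * T / β + C₂ * T ^ 2 + C₂ / β ^ (2 + δ₂)) :
    P ≤ (B₁ + |C₂|) / β ^ 2 + C * T / β + C * T ^ 2 := by
  have hβ0 : 0 < β := lt_of_lt_of_le one_pos hβ
  have e1 : C₂ * T / β ≤ C * T / β :=
    div_le_div_of_nonneg_right (mul_le_mul_of_nonneg_right ((le_abs_self _).trans hC₂) hT) hβ0.le
  have e2 : C₂ * T ^ 2 ≤ C * T ^ 2 :=
    mul_le_mul_of_nonneg_right ((le_abs_self _).trans hC₂) (sq_nonneg _)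
  have e3 : C₂ / β ^ (2 + δ₂) ≤ |C₂| / β ^ 2 :=
    calc C₂ / β ^ (2 + δ₂) ≤ |C₂| / β ^ (2 + δ₂) :=
          div_le_div_of_nonneg_right (le_abs_self _) (Real.rpow_nonneg hβ0.le _)
      _ ≤ |C₂| / β ^ (2 : ℝ) :=
          div_le_div_of_nonneg_left (abs_nonneg _) (Real.rpow_pos_of_pos hβ0 _)
            (Real.rpow_le_rpow_of_exponent_le hβ (by linarith))
      _ = |C₂| / β ^ 2 := by rw [Real.rpow_two]
  rw [add_div]
  linarith

/-- Conjunct (iii): the floor with `C ≥ |C₃|`, `δ ≤ δ₃`, for `β ≥ 1`. -/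
theorem glue_floor {C₃ C δ₃ δ β Q : ℝ} (hC₃ : |C₃| ≤ C) (hδ : δ ≤ δ₃) (hβ : 1 ≤ β)
    (h : -(C₃ / β ^ (1 + δ₃)) ≤ Q) : -(C / β ^ (1 + δ)) ≤ Q := by
  have hβ0 : 0 < β := lt_of_lt_of_le one_pos hβ
  have e1 : C₃ / β ^ (1 + δ₃) ≤ |C₃| / β ^ (1 + δ₃) :=
    div_le_div_of_nonneg_right (le_abs_self _) (Real.rpow_nonneg hβ0.le _)
  have e2 : |C₃| / β ^ (1 + δ₃) ≤ |C₃| / β ^ (1 + δ) :=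
    div_le_div_of_nonneg_left (abs_nonneg _) (Real.rpow_pos_of_pos hβ0 _)
      (Real.rpow_le_rpow_of_exponent_le hβ (by linarith))
  have e3 : |C₃| / β ^ (1 + δ) ≤ C / β ^ (1 + δ) :=
    div_le_div_of_nonneg_right hC₃ (Real.rpow_nonneg hβ0.le _)
  linarith

/-! ## The composition -/

/-- The glue STATEMENT: the three stub signatures (verbatim) imply the crux BY NAME. -/
def Glue : Prop :=
    (∀ (G : Type) [Group G] [TopologicalSpace G] [IsTopologicalGroup G] [CompactSpace G]
      [MeasurableSpace G] [BorelSpace G],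
      Literature.MathematicalPhysics.QuantumFieldTheory.IsCompactSimpleLieGroup G →
      ∀ r : Literature.MathematicalPhysics.QuantumFieldTheory.LatticeRep G,
      ∃ θ A B C δ' : ℝ, ∃ n₀ : ℕ, 0 < θ ∧ θ ≤ 1 / 16 ∧ 0 < A ∧ 0 < δ' ∧
        ∀ n : ℕ, n₀ ≤ n → ∃ β₁ : ℝ, ∀ β : ℝ, β₁ ≤ β →
          let Λ : Finset (Literature.MathematicalPhysics.QuantumLattice.ZdEdge 4) :=
            Literature.Probability.LatticeModels.box 4 ⌈β ^ θ⌉₊ ×ˢ (Finset.univ : Finset (Fin 4))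
          let good : Set (Literature.MathematicalPhysics.QuantumLattice.LGConfig 4 G) :=
            {U | ∀ p ∈ Literature.MathematicalPhysics.QuantumLattice.plaquettesTouching Λ,
              (r.N : ℝ) - Literature.MathematicalPhysics.QuantumLattice.plaquetteObs r.ρ p.1
                p.2.1.1 p.2.1.2 U ≤ β ^ (-(15 : ℝ) / 16)}
          let ν : Literature.MathematicalPhysics.QuantumLattice.LGConfig 4 G →
              MeasureTheory.Measure (Literature.MathematicalPhysics.QuantumLattice.LGConfig 4 G) :=
            fun η => ProbabilityTheory.cond
              (Literature.MathematicalPhysics.QuantumLattice.ymSpecification r.ρ β Λ η) good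
          let x : Literature.Probability.LatticeModels.Site 4 := (n : ℤ) • Pi.single (0 : Fin 4) (1 : ℤ)
          2 * A / (β ^ 2 * (n : ℝ) ^ 8) - C / β ^ (2 + δ') ≤
              Literature.MathematicalPhysics.QuantumLattice.plaquetteCorrFn r.ρ (ν 1) x ∧
            Literature.MathematicalPhysics.QuantumLattice.plaquetteCorrFn r.ρ (ν 1) 0 ≤ B / β ^ 2) →
    (∀ (G : Type) [Group G] [TopologicalSpace G] [IsTopologicalGroup G] [CompactSpace G]
      [MeasurableSpace G] [BorelSpace G],
      Literature.MathematicalPhysics.QuantumFieldTheory.IsCompactSimpleLieGroup G →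
      ∀ r : Literature.MathematicalPhysics.QuantumFieldTheory.LatticeRep G,
      ∀ θ : ℝ, 0 < θ → θ ≤ 1 / 16 → ∃ C δ' : ℝ, 0 < δ' ∧
        ∀ n : ℕ, 1 ≤ n → ∃ β₁ : ℝ, ∀ β : ℝ, β₁ ≤ β →
          let Λ : Finset (Literature.MathematicalPhysics.QuantumLattice.ZdEdge 4) :=
            Literature.Probability.LatticeModels.box 4 ⌈β ^ θ⌉₊ ×ˢ (Finset.univ : Finset (Fin 4))
          let good : Set (Literature.MathematicalPhysics.QuantumLattice.LGConfig 4 G) :=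
            {U | ∀ p ∈ Literature.MathematicalPhysics.QuantumLattice.plaquettesTouching Λ,
              (r.N : ℝ) - Literature.MathematicalPhysics.QuantumLattice.plaquetteObs r.ρ p.1
                p.2.1.1 p.2.1.2 U ≤ β ^ (-(15 : ℝ) / 16)}
          let ν : Literature.MathematicalPhysics.QuantumLattice.LGConfig 4 G →
              MeasureTheory.Measure (Literature.MathematicalPhysics.QuantumLattice.LGConfig 4 G) :=
            fun η => ProbabilityTheory.cond
              (Literature.MathematicalPhysics.QuantumLattice.ymSpecification r.ρ β Λ η) good
          let D : Literature.Probability.LatticeModels.Site 4 →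
              Literature.MathematicalPhysics.QuantumLattice.LGConfig 4 G → ℝ := fun y η =>
            (∫ U, ((r.N : ℝ) - Literature.MathematicalPhysics.QuantumLattice.plaquetteObs r.ρ y 0 1 U)
                ∂(ν η)) -
              ∫ U, ((r.N : ℝ) - Literature.MathematicalPhysics.QuantumLattice.plaquetteObs r.ρ y 0 1 U)
                ∂(ν 1)
          let x : Literature.Probability.LatticeModels.Site 4 := (n : ℤ) • Pi.single (0 : Fin 4) (1 : ℤ)
          ∀ ω : Literature.MathematicalPhysics.QuantumLattice.LGConfig 4 G,
            (2⁻¹ : ENNReal) ≤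
                Literature.MathematicalPhysics.QuantumLattice.ymSpecification r.ρ β Λ ω good →
              Literature.MathematicalPhysics.QuantumLattice.plaquetteCorrFn r.ρ (ν 1) x -
                    C * (max (D 0 ω) 0 + max (D x ω) 0) / (β * (n : ℝ) ^ 4) -
                    C * (max (D 0 ω) 0 + max (D x ω) 0) ^ 2 - C / β ^ (2 + δ') ≤
                  Literature.MathematicalPhysics.QuantumLattice.plaquetteCorrFn r.ρ (ν ω) x ∧
                Literature.MathematicalPhysics.QuantumLattice.plaquetteCorrFn r.ρ (ν ω) 0 ≤
                  Literature.MathematicalPhysics.QuantumLattice.plaquetteCorrFn r.ρ (ν 1) 0 +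
                    C * max (D 0 ω) 0 / β + C * max (D 0 ω) 0 ^ 2 + C / β ^ (2 + δ')) →
    (∀ (G : Type) [Group G] [TopologicalSpace G] [IsTopologicalGroup G] [CompactSpace G]
      [MeasurableSpace G] [BorelSpace G],
      Literature.MathematicalPhysics.QuantumFieldTheory.IsCompactSimpleLieGroup G →
      ∀ r : Literature.MathematicalPhysics.QuantumFieldTheory.LatticeRep G,
      ∀ θ : ℝ, 0 < θ → θ ≤ 1 / 16 → ∃ C δ' : ℝ, 0 < δ' ∧
        ∀ n : ℕ, ∃ β₁ : ℝ, ∀ β : ℝ, β₁ ≤ β →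
          let Λ : Finset (Literature.MathematicalPhysics.QuantumLattice.ZdEdge 4) :=
            Literature.Probability.LatticeModels.box 4 ⌈β ^ θ⌉₊ ×ˢ (Finset.univ : Finset (Fin 4))
          let good : Set (Literature.MathematicalPhysics.QuantumLattice.LGConfig 4 G) :=
            {U | ∀ p ∈ Literature.MathematicalPhysics.QuantumLattice.plaquettesTouching Λ,
              (r.N : ℝ) - Literature.MathematicalPhysics.QuantumLattice.plaquetteObs r.ρ p.1
                p.2.1.1 p.2.1.2 U ≤ β ^ (-(15 : ℝ) / 16)}
          let ν : Literature.MathematicalPhysics.QuantumLattice.LGConfig 4 G →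
              MeasureTheory.Measure (Literature.MathematicalPhysics.QuantumLattice.LGConfig 4 G) :=
            fun η => ProbabilityTheory.cond
              (Literature.MathematicalPhysics.QuantumLattice.ymSpecification r.ρ β Λ η) good
          let D : Literature.Probability.LatticeModels.Site 4 →
              Literature.MathematicalPhysics.QuantumLattice.LGConfig 4 G → ℝ := fun y η =>
            (∫ U, ((r.N : ℝ) - Literature.MathematicalPhysics.QuantumLattice.plaquetteObs r.ρ y 0 1 U)
                ∂(ν η)) -
              ∫ U, ((r.N : ℝ) - Literature.MathematicalPhysics.QuantumLattice.plaquetteObs r.ρ y 0 1 U)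
                ∂(ν 1)
          let x : Literature.Probability.LatticeModels.Site 4 := (n : ℤ) • Pi.single (0 : Fin 4) (1 : ℤ)
          ∀ ω : Literature.MathematicalPhysics.QuantumLattice.LGConfig 4 G,
            (2⁻¹ : ENNReal) ≤
                Literature.MathematicalPhysics.QuantumLattice.ymSpecification r.ρ β Λ ω good →
              -(C / β ^ (1 + δ')) ≤ D 0 ω ∧ -(C / β ^ (1 + δ')) ≤ D x ω) →
    BoxLaplace

/-- **The glue, `sorry`-free**: stub₁-statement → stub₂-statement → stub₃-statement → the crux.
Instantiate stubs 2 and 3 at stub 1's `θ`; merge `C := |C₁| + |C₂| + |C₃|`,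
`δ' := min δ₁ (min δ₂ δ₃)`, `B := B₁ + |C₂|`, `n₀ := max n₀ 1`, `β₁ := max` of the three
thresholds and `1`; then `glue_cov`, `glue_var`, `glue_floor`. -/
theorem glue : Glue := by
  intro h₁ h₂ h₃ G _ _ _ _ _ _ hG r
  obtain ⟨θ, A, B₁, C₁, δ₁, n₀, hθ, hθ', hA, hδ₁, H₁⟩ := h₁ G hG r
  obtain ⟨C₂, δ₂, hδ₂, H₂⟩ := h₂ G hG r θ hθ hθ'
  obtain ⟨C₃, δ₃, hδ₃, H₃⟩ := h₃ G hG r θ hθ hθ'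
  refine ⟨θ, A, |C₁| + |C₂| + |C₃|, min δ₁ (min δ₂ δ₃), B₁ + |C₂|, max n₀ 1, hθ, hθ', hA,
    lt_min hδ₁ (lt_min hδ₂ hδ₃), ?_⟩
  intro n hn
  obtain ⟨b₁, H₁'⟩ := H₁ n ((le_max_left _ _).trans hn)
  obtain ⟨b₂, H₂'⟩ := H₂ n ((le_max_right _ _).trans hn)
  obtain ⟨b₃, H₃'⟩ := H₃ n
  refine ⟨max (max b₁ b₂) (max b₃ 1), ?_⟩
  intro β hβ
  have hb₁ : b₁ ≤ β := ((le_max_left _ _).trans (le_max_left _ _)).trans hβ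
  have hb₂ : b₂ ≤ β := ((le_max_right _ _).trans (le_max_left _ _)).trans hβ
  have hb₃ : b₃ ≤ β := ((le_max_left _ _).trans (le_max_right _ _)).trans hβ
  have hβ1 : (1 : ℝ) ≤ β := ((le_max_right _ _).trans (le_max_right _ _)).trans hβ
  have hC₂ : |C₂| ≤ |C₁| + |C₂| + |C₃| := by
    linarith [abs_nonneg C₁, abs_nonneg C₃]
  have hC₃ : |C₃| ≤ |C₁| + |C₂| + |C₃| := by
    linarith [abs_nonneg C₁, abs_nonneg C₂]
  have hC₁₂ : |C₁| + |C₂| ≤ |C₁| + |C₂| + |C₃| := by linarith [abs_nonneg C₃]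
  have hmin₁ : min δ₁ (min δ₂ δ₃) ≤ δ₁ := min_le_left _ _
  have hmin₂ : min δ₁ (min δ₂ δ₃) ≤ δ₂ := (min_le_right _ _).trans (min_le_left _ _)
  have hmin₃ : min δ₁ (min δ₂ δ₃) ≤ δ₃ := (min_le_right _ _).trans (min_le_right _ _)
  intro Λ good ν D x ω hω
  have f₁ := H₁' β hb₁
  have f₂ := H₂' β hb₂ ω hω
  have f₃ := H₃' β hb₃ ω hω
  refine ⟨?_, ?_, ?_, ?_⟩
  · exact glue_cov hC₂ hC₁₂ hmin₁ hmin₂ hβ1 (Nat.cast_nonneg n)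
      (add_nonneg (le_max_right _ _) (le_max_right _ _)) f₁.1 f₂.1
  · exact glue_var hC₂ hδ₂.le hβ1 (le_max_right _ _) f₁.2 f₂.2
  · exact glue_floor hC₃ hmin₃ hβ1 f₃.1
  · exact glue_floor hC₃ hmin₃ hβ1 f₃.2

/-- **Registered form** (what `ledger skeleton check` audits): the crux BY NAME from the three
stubs BY NAME, through the `sorry`-free `glue`. -/
theorem BoxLaplace_of : BoxLaplace :=
  glue stub_flatBoxGaussianity stub_backgroundSecondOrder stub_excessFloor

/-- Signature match (kernel-checked): the conclusion is literally the route decl. -/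
example : Summit.QuantumFields.YangMills.Theses.DirichletWindow.BoxLaplace := BoxLaplace_of

end Summit.QuantumFields.YangMills.Cruxes.BoxLaplace.Birth

end
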